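import Summits.BirchSwinnertonDyer.Rank1Residual.X11b.RungK2Leaves
import HarnessLib

/-!
# Route `ClassRecordThree` (rung K2@3): the leaf `X11b.MultiplicativeRankOneAtThree` WITHOUT the
# Schneider binder — road (b) on ALL of (ram)  (D-0145 ideator seat bsd-idea-4 gen 7;
# `--supports stmt-BirchSwinnertonDyer-19106 --as helper`; SWAP analysis, evidence #44–46 on 19106)

HELPER / structural-knowledge file. BSD is not proved; the leaf stays CONDITIONAL on every binder.
What IS proved (sorry-free, a 25-line composition of tree theorems):

* `SchneiderFree.forall_bsdp_of_bdpRoadOnRam` — `BSD(E,3)` at every pair of class X11b at `3`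
  from the binder list of the route's kernel of record `Three.forall_bsdp_of_classRecord_v45'`
  (X11b/Three/ClassRecordEP.lean) with road (a)'s per-pair binder
  `hReg : ClassX11b W 3 → Ram W 3 → ¬ split(3) → ClassClosure.RegulatorNonvanishingAt W 3`
  (= crux 19106 `SchneiderAtThree` verbatim) and road (a)'s five published facts DELETED, and road
  (b)'s four typed binders (`hDb`, `hHb`, `hSh`, `hUγ`) WIDENED from `Ram ∧ split(3)` to `Ram` (the
  hypothesis `W.HasSplitMultiplicativeReductionAtPrime 3` dropped; `ShapeAlpha ⇒ split`, so `hUα`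
  needs no change). Per pair: `Surj W 3` from `Irr ∧ Ram`, then the road-(b)/(d) machine
  `Three.bsdp_three_of_surj_of_stepLAt_of_shapes` (which never had a split hypothesis) fed by
  `Three.stepLAt_of_halves₃_of_classX11b_of_hsieh2014_of_descent` (λ-supply = the theorem
  `Three.lambdaSupplyAt₃`); the `¬Surj` corner verbatim as in v4.1.
* `SchneiderFree.multiplicativeRankOneAtThree_of_bdpRoadOnRam` — the rung leaf from the same
  binders: the `closes` shape of a Schneider-free ClassRecordThree (19106 → aside; HsiehDescent and
  H2 ∧ H3 on `Surj`; 19109's γ-clause and the pure-β displays without 'split').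
Reading (memo `pub/ideators/bsd-idea-4/lines/g7/SWAP-19106-memo.md`): for the ∀-class theorem the
road partition of CR3 v4 was a choice; Schneider's non-degeneracy at `3` is not load-bearing for the
leaf. Road (b)'s printed engine is uniform in `a_p = ±1` and its hypothesis at `p ∣ N` is exactly
(ram) [Castella 2018, Thm. A]. Nothing booked; no label change; no route opened or edited here.
[cite: Castella2018, Thm. A (arXiv:1704.06608 p. 3) (road (b) uniform in the reduction sign at p; hypothesis at p ∣ N = (ram))]
[cite: Hsieh2014, Thm. 1 (arXiv:1112.1580 pp. 3–4)] [cite: MatarNekovar2019, Thm. 0.3 (p. 456)]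
-/

noncomputable section

open scoped Classical

open WeierstrassCurve NumberField IsDedekindDomain Field Literature.NumberTheory.EllipticCurves
  Rat.HeightOneSpectrum
  Literature.NumberTheory.DiophantineGeometry
  Literature.NumberTheory.EllipticCurves.GreenbergSelmer
  Literature.NumberTheory.EllipticCurves.ModularForms
  Literature.NumberTheory.EllipticCurves.Rank1Residual
  Literature.NumberTheory.EllipticCurves.Rank1Residual.Typed
  Literature.NumberTheory.EllipticCurves.Wuthrich2014
  Literature.NumberTheory.EllipticCurves.BalakrishnanEtAl2019
  Literature.NumberTheory.EllipticCurves.Skinner2016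
  Literature.NumberTheory.EllipticCurves.SteinWuthrich2013
  Literature.NumberTheory.EllipticCurves.Disegni2020
  Literature.NumberTheory.EllipticCurves.BarriosEtAl2025
  Literature.NumberTheory.QuadraticFields.Quadratic
  Literature.NumberTheory.Automorphic
  Literature.NumberTheory.GaloisRepresentations Literature.NumberTheory.GaloisCohomology
  Summit.BirchSwinnertonDyer.Rank1Residual.X11b.AcSelmer
  Summit.BirchSwinnertonDyer.Rank1Residual.X11b.LocBridge

namespace Summit.BirchSwinnertonDyer.Rank1Residual.X11b.Three.SchneiderFree

/-- **X11b at `p = 3`, WHOLE CLASS, NO Schneider binder.** The binder list of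
`Three.forall_bsdp_of_classRecord_v45'` with `hReg` and road (a)'s five published facts
(`hSkA hJn hHn hD hpar`) removed, and road (b)'s `hDb`/`hHb`/`hSh`/`hUγ` stated on ALL of `Ram`
(split hypothesis dropped). CONDITIONAL on every listed binder; nothing booked. -/
theorem forall_bsdp_of_bdpRoadOnRam [Fact (Nat.Prime 3)]
    -- PUBLISHED: the named facts of route p2 (hEP supplied by the tree, as in v4.5′)
    (hGZ : ∀ (N : ℕ) [NeZero N] (W : WeierstrassCurve ℚ) (K : Type) [Field K] [NumberField K],
      gross_zagier N W K)
    (hKo : ∀ (N : ℕ) [NeZero N] (W : WeierstrassCurve ℚ) (K : Type) [Field K] [NumberField K],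
      kolyvagin N W K)
    (hB : ∀ (N : ℕ) [NeZero N] (W : WeierstrassCurve ℚ) (K : Type) [Field K] [NumberField K],
      Kolyvagin1990_padicValNat_card_sha_le N W K)
    (hSk : Skinner2016.thmC_padicValRat_bsd_rank_zero) (hWu : sha_dvd_analyticSha)
    (hGZK : rank_eq_analyticRank_of_analyticRank_le_one) (hmod : hasEntireLFunction_rat)
    (hnf : exists_isNewformOf) (hHL : HoffsteinLuo1997_exists_twist_L_one_ne_zero)
    (hMaz : mazur_not_dvd_maninConstant_of_odd)
    (hPT : ∀ (K : Type) [Field K] [NumberField K], poitouTate_sum_localTatePairing_eq_zero K)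
    -- PUBLISHED: Friedberg–Hoffstein, Barrios et al. 2025, Matar–Nekovář 2019, Hsieh 2014 Thm. 1
    (hFH : friedbergHoffstein_exists_twist_ne_zero_inertAt)
    (hBR : localTamagawaNumber_quadraticTwist_two_mem_of_goodReduction)
    (hMN : ∀ (N : ℕ) [NeZero N] (W : WeierstrassCurve ℚ) (K : Type) [Field K] [NumberField K],
      MatarNekovar2019.thm03_padicValNat_card_sha_le_of_irreducible N W K)
    (hH : hsieh2014_exists_anticyclotomicPAdicLFunction)
    -- ROAD (b′) = ALL OF (ram), split OR non-split at 3: descent residual, H2 ∧ H3, pure-β displays,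
    -- (α) and (γ∖α) upper halves — v4.5′'s road-(b) binders with the split hypothesis DROPPED
    (hDr : ∀ (W : WeierstrassCurve ℚ) [W.IsElliptic] [W.IsGloballyMinimal],
      ClassX11b W 3 → Ram W 3 → HsiehDescentAt₃ W)
    (hHr : ∀ (W : WeierstrassCurve ℚ) [W.IsElliptic] [W.IsGloballyMinimal],
      ClassX11b W 3 → Ram W 3 → BDPValueAt₃ W ∧ IMCDivAt₃ W)
    (hSh : ∀ (W : WeierstrassCurve ℚ) [W.IsElliptic] [W.IsGloballyMinimal],
      ClassX11b W 3 → Ram W 3 → ¬ ShapeAlpha W → ¬ ShapeGamma W → 3 ∣ W.tamagawaProduct →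
        P2ShimuraDisplaysAt W 3)
    (hUα : ∀ (W : WeierstrassCurve ℚ) [W.IsElliptic] [W.IsGloballyMinimal],
      ClassX11b W 3 → Ram W 3 → ShapeAlpha W → Typed.MissingUpperBoundAt W 3)
    (hUγ : ∀ (W : WeierstrassCurve ℚ) [W.IsElliptic] [W.IsGloballyMinimal],
      ClassX11b W 3 → Ram W 3 → ¬ ShapeAlpha W → ShapeGamma W → Typed.MissingUpperBoundAt W 3)
    -- ROAD (d) `¬Ram ∧ Surj`: verbatim v4.5′
    (hDd : ∀ (W : WeierstrassCurve ℚ) [W.IsElliptic] [W.IsGloballyMinimal],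
      ClassX11b W 3 → ¬ Ram W 3 → Surj W 3 → HsiehDescentAt₃ W)
    (hHd : ∀ (W : WeierstrassCurve ℚ) [W.IsElliptic] [W.IsGloballyMinimal],
      ClassX11b W 3 → ¬ Ram W 3 → Surj W 3 → BDPValueAt₃ W ∧ IMCDivAt₃ W)
    (hU₀ : ∀ (W : WeierstrassCurve ℚ) [W.IsElliptic] [W.IsGloballyMinimal],
      ClassX11b W 3 → Surj W 3 → ¬ Ram W 3 → Typed.MissingUpperBoundAt W 3)
    -- THE (T4″)@3 CORNER `¬Surj`: verbatim v4.5′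
    (hCL : ∀ (W : WeierstrassCurve ℚ) [W.IsElliptic] [W.IsGloballyMinimal], CornerStepLAt W)
    (hCT : ∀ (W : WeierstrassCurve ℚ) [W.IsElliptic] [W.IsGloballyMinimal], CornerTwistAt W)
    (hCU : ∀ (W : WeierstrassCurve ℚ) [W.IsElliptic] [W.IsGloballyMinimal], CornerUpperAt W)
    (W : WeierstrassCurve ℚ) [W.IsElliptic] [W.IsGloballyMinimal] (hX : ClassX11b W 3) :
    BSDp W 3 := by
  have hEP : ∀ (K : Type) [Field K] [NumberField K] (v : HeightOneSpectrum (𝓞 K)),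
      localEulerPoincareCharacteristic (v.adicCompletion K) :=
    GaloisImage.EP.localEulerPoincareCharacteristic_adicCompletion
  by_cases hsurj : Surj W 3
  · -- roads (b′) ∪ (d): STEP L at the pair from descent + H2 ∧ H3, then the shapes machine
    have hL : StepLAt W := by
      by_cases hram : Ram W 3
      · exact stepLAt_of_halves₃_of_classX11b_of_hsieh2014_of_descent hnf hKo hPT hEP hH
          lambdaSupplyAt₃ hX (hDr W hX hram) (hHr W hX hram).1 (hHr W hX hram).2
      · exact stepLAt_of_halves₃_of_classX11b_of_hsieh2014_of_descent hnf hKo hPT hEP hH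
          lambdaSupplyAt₃ hX (hDd W hX hram hsurj) (hHd W hX hram hsurj).1 (hHd W hX hram hsurj).2
    exact bsdp_three_of_surj_of_stepLAt_of_shapes hGZ hKo hB hSk hWu hGZK hmod hnf hHL hMaz hFH hBR
      hPT hEP W hX hsurj hL (fun hram hα hγ ht ↦ hSh W hX hram hα hγ ht)
      (fun hram hα ↦ hUα W hX hram hα) (fun hram hα hγ ↦ hUγ W hX hram hα hγ)
      (fun hnram ↦ hU₀ W hX hsurj hnram)
  · -- the corner, exactly as in v4.1 (`Three.forall_bsdp_of_classRecord_v41`)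
    have hU : ∀ (W : WeierstrassCurve ℚ) [W.IsElliptic] [W.IsGloballyMinimal],
        ClassX11b W 3 → ¬ Surj W 3 → 3 ∣ W.tamagawaProduct → Typed.MissingUpperBoundAt W 3 :=
      fun W _ _ hX hns ht ↦
        missingUpperBoundAt_of_cornerUpperAt hGZ hKo hGZK hmod hnf hHL hMaz W hX hns ht (hCU W) (hCT W)
    obtain ⟨hdvd, hnr⟩ := ClassX11b.dvd_and_not_ram_of_not_surj W 3 hX hsurj
    refine Typed.bsdp_of_missingPPartAt W 3 hGZK (by rw [hX.1]) ?_
    by_cases hs : W.HasSplitMultiplicativeReductionAtPrime 3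
    · exact missingPPartAt_of_corner_split_of_inputs hGZ hKo hGZK hmod hnf hHL hMaz hPT hEP hMN
        (fun W _ _ ↦ hCL W) (fun W _ _ ↦ hCT W) hU W hX hsurj hdvd hnr hs
    · exact missingPPartAt_of_corner_nonsplit_of_inputs hGZ hKo hGZK hmod hnf hHL hMaz hPT hEP hMN
        (fun W _ _ ↦ hCL W) (fun W _ _ ↦ hCT W) hU W hX hsurj hdvd hnr hs

/-- **The rung leaf WITHOUT Schneider**: `X11b.MultiplicativeRankOneAtThree` from the binders of
`forall_bsdp_of_bdpRoadOnRam` — the would-be `closes` shape of a Schneider-free ClassRecordThree. -/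
theorem multiplicativeRankOneAtThree_of_bdpRoadOnRam [Fact (Nat.Prime 3)]
    (hGZ : ∀ (N : ℕ) [NeZero N] (W : WeierstrassCurve ℚ) (K : Type) [Field K] [NumberField K],
      gross_zagier N W K)
    (hKo : ∀ (N : ℕ) [NeZero N] (W : WeierstrassCurve ℚ) (K : Type) [Field K] [NumberField K],
      kolyvagin N W K)
    (hB : ∀ (N : ℕ) [NeZero N] (W : WeierstrassCurve ℚ) (K : Type) [Field K] [NumberField K],
      Kolyvagin1990_padicValNat_card_sha_le N W K)
    (hSk : Skinner2016.thmC_padicValRat_bsd_rank_zero) (hWu : sha_dvd_analyticSha)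
    (hGZK : rank_eq_analyticRank_of_analyticRank_le_one) (hmod : hasEntireLFunction_rat)
    (hnf : exists_isNewformOf) (hHL : HoffsteinLuo1997_exists_twist_L_one_ne_zero)
    (hMaz : mazur_not_dvd_maninConstant_of_odd)
    (hPT : ∀ (K : Type) [Field K] [NumberField K], poitouTate_sum_localTatePairing_eq_zero K)
    (hFH : friedbergHoffstein_exists_twist_ne_zero_inertAt)
    (hBR : localTamagawaNumber_quadraticTwist_two_mem_of_goodReduction)
    (hMN : ∀ (N : ℕ) [NeZero N] (W : WeierstrassCurve ℚ) (K : Type) [Field K] [NumberField K],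
      MatarNekovar2019.thm03_padicValNat_card_sha_le_of_irreducible N W K)
    (hH : hsieh2014_exists_anticyclotomicPAdicLFunction)
    (hDr : ∀ (W : WeierstrassCurve ℚ) [W.IsElliptic] [W.IsGloballyMinimal],
      ClassX11b W 3 → Ram W 3 → HsiehDescentAt₃ W)
    (hHr : ∀ (W : WeierstrassCurve ℚ) [W.IsElliptic] [W.IsGloballyMinimal],
      ClassX11b W 3 → Ram W 3 → BDPValueAt₃ W ∧ IMCDivAt₃ W)
    (hSh : ∀ (W : WeierstrassCurve ℚ) [W.IsElliptic] [W.IsGloballyMinimal],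
      ClassX11b W 3 → Ram W 3 → ¬ ShapeAlpha W → ¬ ShapeGamma W → 3 ∣ W.tamagawaProduct →
        P2ShimuraDisplaysAt W 3)
    (hUα : ∀ (W : WeierstrassCurve ℚ) [W.IsElliptic] [W.IsGloballyMinimal],
      ClassX11b W 3 → Ram W 3 → ShapeAlpha W → Typed.MissingUpperBoundAt W 3)
    (hUγ : ∀ (W : WeierstrassCurve ℚ) [W.IsElliptic] [W.IsGloballyMinimal],
      ClassX11b W 3 → Ram W 3 → ¬ ShapeAlpha W → ShapeGamma W → Typed.MissingUpperBoundAt W 3)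
    (hDd : ∀ (W : WeierstrassCurve ℚ) [W.IsElliptic] [W.IsGloballyMinimal],
      ClassX11b W 3 → ¬ Ram W 3 → Surj W 3 → HsiehDescentAt₃ W)
    (hHd : ∀ (W : WeierstrassCurve ℚ) [W.IsElliptic] [W.IsGloballyMinimal],
      ClassX11b W 3 → ¬ Ram W 3 → Surj W 3 → BDPValueAt₃ W ∧ IMCDivAt₃ W)
    (hU₀ : ∀ (W : WeierstrassCurve ℚ) [W.IsElliptic] [W.IsGloballyMinimal],
      ClassX11b W 3 → Surj W 3 → ¬ Ram W 3 → Typed.MissingUpperBoundAt W 3)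
    (hCL : ∀ (W : WeierstrassCurve ℚ) [W.IsElliptic] [W.IsGloballyMinimal], CornerStepLAt W)
    (hCT : ∀ (W : WeierstrassCurve ℚ) [W.IsElliptic] [W.IsGloballyMinimal], CornerTwistAt W)
    (hCU : ∀ (W : WeierstrassCurve ℚ) [W.IsElliptic] [W.IsGloballyMinimal], CornerUpperAt W) :
    X11b.MultiplicativeRankOneAtThree :=
  fun W _ _ hX ↦ forall_bsdp_of_bdpRoadOnRam hGZ hKo hB hSk hWu hGZK hmod hnf hHL hMaz hPT hFH hBR
    hMN hH hDr hHr hSh hUα hUγ hDd hHd hU₀ hCL hCT hCU W hX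

/-- **Sanity (the deleted locus is really absorbed)**: on the non-split locus `ShapeAlpha` is
impossible, so the only Tamagawa sub-atoms road (b′) adds on `Ram ∧ nonsplit(3)` are pure-β
(`hSh`) and γ (`hUγ`); with `3 ∤ ∏c` the upper half is the unconditional A1 atom. -/
theorem not_shapeAlpha_of_nonsplit [Fact (Nat.Prime 3)] (W : WeierstrassCurve ℚ) [W.IsElliptic]
    [W.IsGloballyMinimal] (hns : ¬ W.HasSplitMultiplicativeReductionAtPrime 3) : ¬ ShapeAlpha W :=
  fun h ↦ hns h.1


end Summit.BirchSwinnertonDyer.Rank1Residual.X11b.Three.SchneiderFree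

end
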